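import Literature.NumberTheory.Transcendental.BakerLogarithmsConclusion

/-!
# `NormalFormPrinciple` (stmt-KontsevichZagierPeriods-3869), line `SketchIdeator1` — Baker's
# theorem in coefficient form (a reusable corollary for the Baker endgames of the leaf)

Pure proof file (`--supports` the crux stmt-KontsevichZagierPeriods-3869; no definitions).  Its sole
content is the complex COEFFICIENT FORM of Baker's theorem,
`eq_zero_of_isAlgebraic_of_add_sum_mul_eq_zero`: for a finite index type `ι`, complex numbers
`lᵢ` with `e^{lᵢ}` algebraic and `l` linearly independent over `ℚ`, and ALGEBRAIC `β₀, βᵢ ∈ ℂ`,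
`β₀ + Σᵢ βᵢ lᵢ = 0` forces `β₀ = 0` and every `βᵢ = 0`.  It is Baker's theorem as it stands in
the tree (`Literature.NumberTheory.Transcendental.baker_holds`: the family `1, l₁, l₂, …`,
`Option.elim · 1 l`, is linearly independent over `ℚ̄ = algebraicClosure ℚ ℂ`) read through
Mathlib's `Fintype.linearIndependent_iff` with the coefficient family `Option.elim · β₀ β` in `ℚ̄`.

Use.  The Baker endgames of the algebraic-pole and arctangent layers of the leaf `stub_boxRigidity`
are specialisations: real logarithms `lᵢ = log εᵢ` (the registered sub-goal
`eq_zero_of_alg_add_sum_mul_log_eq_zero`, already discharged in the tree as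
`…NormalFormPrinciple.PiBox.Dlog.eq_zero_of_alg_add_sum_mul_log_eq_zero`,
`…NormalFormPrincipleAlgBaker.lean` — not restated here), and mixed families
`Sum.elim (log ε) (fun k => θ k * I)` on `Fin s ⊕ Fin s'` for logarithms and angles.  Transport
`ℝ → ℂ`: `PrasadRapinchuk.linearIndependent_ofReal_comp_iff`, `PrasadRapinchuk.isAlgebraic_cexp_ofReal_iff`
(`Literature/NumberTheory/Transcendental/PrasadRapinchukLengths.lean`), `isAlgebraic_algebraMap_iff`,
`norm_cast`.

Source: A. Baker, *Transcendental Number Theory* (Cambridge, 1975), Theorem 2.1.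
-/

noncomputable section

namespace Summit.KontsevichZagierPeriods.HurwitzMicroSectors.NormalFormPrinciple.PiBox.BakerLinearForms

open Literature.NumberTheory.Transcendental

/-- **Baker's theorem, coefficient form** (from `baker_holds`; Baker 1975, Theorem 2.1): if `ι` is
finite, `e^{lᵢ}` is algebraic for every `i`, the `lᵢ` are linearly independent over `ℚ`, and
`β₀ + Σᵢ βᵢ lᵢ = 0` with ALGEBRAIC complex numbers `β₀, βᵢ`, then `β₀ = 0` and every `βᵢ = 0`.
Proof: `Fintype.linearIndependent_iff` for the `ℚ̄`-linearly independent family `1, l₁, l₂, …`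
(`baker_holds`) and the coefficient family `Option.elim · β₀ β` in `ℚ̄ = algebraicClosure ℚ ℂ`.
[cite: Baker1975, Theorem 2.1] -/
theorem eq_zero_of_isAlgebraic_of_add_sum_mul_eq_zero {ι : Type*} [Fintype ι] (l : ι → ℂ)
    (halg : ∀ i, IsAlgebraic ℚ (Complex.exp (l i))) (hli : LinearIndependent ℚ l)
    (β₀ : ℂ) (β : ι → ℂ) (hβ₀ : IsAlgebraic ℚ β₀) (hβ : ∀ i, IsAlgebraic ℚ (β i))
    (h : β₀ + ∑ i, β i * l i = 0) : β₀ = 0 ∧ ∀ i, β i = 0 := by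
  -- the coefficients, as elements of the field `ℚ̄` of all algebraic numbers
  let g : Option ι → algebraicClosure ℚ ℂ := fun o =>
    o.elim ⟨β₀, mem_algebraicClosure_iff.2 hβ₀⟩ fun i => ⟨β i, mem_algebraicClosure_iff.2 (hβ i)⟩
  have hg : ∀ o, g o = 0 :=
    Fintype.linearIndependent_iff.1 (baker_holds l halg hli) g
      (by simpa [g, Fintype.sum_option, IntermediateField.smul_def] using h)
  exact ⟨by simpa [g] using congrArg Subtype.val (hg none),
    fun i => by simpa [g] using congrArg Subtype.val (hg (some i))⟩

end Summit.KontsevichZagierPeriods.HurwitzMicroSectors.NormalFormPrinciple.PiBox.BakerLinearForms
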